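import Summits.BirchSwinnertonDyer.Rank1Residual.Supersingular.BlindPointFlatTwo
import Summits.BirchSwinnertonDyer.Rank1Residual.F1Sign2.BlindOrderAtChi8
import Literature.NumberTheory.EllipticCurves.QuadraticTwist
import Literature.NumberTheory.EllipticCurves.Rank1Residual.Predicates
import Literature.NumberTheory.EllipticCurves.GlobalMinimalModel
import Literature.NumberTheory.EllipticCurves.MazurTateElementOdd
import Literature.NumberTheory.EllipticCurves.AnalyticRank
import HarnessLib

/-!
# `BlindOrderTaylorAN59` — cell `bsd-f1-sign2` (`p = 2`, non-CM), analytic lens (seat `-an`) g41 §45: SECOND ORDER AT THE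
# ORDER-2 CHARACTER `ψ₂` (`T = −2`) — the Taylor dictionary for the order laws AN-5/AN-6 (P-an-45D), the `a₂ = ±2` ORDER LAW
# with its BLIND COMBINATION `5·L♭ + a₂·L♯` (P-an-45T), and the derivative shadows of the `♯/♭` functional equations (P-an-45S±)

HONEST FRAMING (planner seat `bsd-f1-sign2-an` g41, HOME `run/shared/lean/pub/bsd-f1-sign2/`, MEMO-an.md v2.04 §45, census
`Cruxes/RankOneAtTwoBigImageOddLocal/CensusAN48.md`): STATEMENTS ONLY — five `@[conjecture] def`s (OPEN obligations of ours: P-an-45T / P-an-45T⁻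
conjecture-grade; P-an-45D and P-an-45S± support-grade = theorems EXPECTED from tree pieces, not proved here) and two kernel-checked
bookkeeping lemmas; nothing asserted about any curve, no Literature fact, no route, nothing booked; PARTITION: none moved (lens work;
bears on route `ByReductionTypeAtTwo`, cruxes 19097 `SupersingularRankZeroAtTwo` / 19098 `AdditiveRankZeroAtTwo` — the twists
`E^{(±2)}` are additive at `2`); beyond-print theorem: **no**. `lean check` rc 0, 0 warnings, 0 sorries; BC7 crux probe
(`HarnessLib.Audit.CruxProbe`, summit := `…Theses.ByReductionTypeAtTwo.RankOneAtTwoBigImageOddLocal`, batteries P1–P5, 90 s each):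
**5/5 `VERDICT: CLEAN`** (no cheap proof, hypotheses not vacuous, no rigidity template fires, `C → S` and `S → C` both fail).

DEDUP (read before typing): the ORDER LAW at `ψ₂` for `a₂ = 0` is ALREADY the tree's `F1Sign2.BlindOrderAtChi8` (AN-5:
`ord₋₂ L♯ = r₂`, `ord₋₂ L♭ = |r₂ − 1|`), `F1Sign2.BlindZeroSimpleIff`, `F1Sign2.BlindOrderOddBranchAtTwo` (AN-6, odd branch) with
λ-shadows `SignedLambdaBoundsAtChi8` / `…OddBranchAtTwo` / `SignedLambdaBoundsAtChi8TraceTwo` (AN-5T, `a₂ = ±2`) and algebraic twins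
`FlatCorankAtChi8` / `SharpCorankAtChi8`; NOTHING here re-words them. What the tree did NOT have and §45 supplies: (a) any MEASUREMENT of
the EXACT order at `ψ₂` — AN-5's witness was the λ-shadow only (lower bounds + parity; equality undecidable without `L♭′(ψ₂)`); (b) the
`a₂ = ±2` ORDER law (only its λ-shadow AN-5T and the VALUE law `BlindFlat.flatLaw_evalAt_neg_two_cases` were typed); (c) the Taylor
dictionary that turns `HasOrderAtNegTwo` into numerically decidable statements; (d) the second-order validation of the in-tree functional
equations (`subst_invOnePlusSubOne_eq_of_isSprungPair_two`, `…_of_isSprungPairOdd_two`).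

WHAT §45 MEASURED (engine52 = PARI overconvergent modular symbols at `p = 2` with SECOND-ORDER integrals + Sprung's `Log` matrix and its
two `T`-derivatives at `T = −2`, `f`-normalised like `msfromell`'s `x^±`; theta53 = Mazur–Tate vectors `θ^{eng,±}_n`, `n ≤ 8`, same
normalisation ⇒ `μ`, `λ` of `L♯`, `L♭`; every optimal good-supersingular-at-2 class with `N ≤ 3000` — `a₂ = 0`: 568 classes, `a₂ = ±2`:
640 classes — both signs, plus the `r₂ = 3` class 8961b1; per (class, sign) the Taylor data `s = −θ₁(ψ₂)` (exact), `s′, s″, b, b′` to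
`≥ 2³³`):
* ORDER CERTIFICATE (CensusAN48 §A): the zero pattern of `(s, s′, s″ | b, b′)` is the one predicted by `ord L♯ = r₂`,
  `ord L♭ = |r₂ − 1|` (`a₂ = 0`) resp. `r₂ ∸ 1` (`a₂ = ±2`) on **2417/2417 rows, 0 violations** (`r₂ = 0`: 881 rows, `r₂ = 1`:
  1329, `r₂ = 2`: 206, `r₂ = 3`: 1); in particular the BLIND DERIVATIVE `b′ = L♭′(ψ₂) ≠ 0` on all 505 even-locus rows of `a₂ = 0`
  (`r₂ ∈ {0, 2}`: the forced zero of `L♭` at `ψ₂` is SIMPLE — AN-5's `|r₂ − 1| = 1`, decided for the first time) and `s″ ≠ 0 ∧ b′ ≠ 0` on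
  all 206 rows with `r₂ = 2`.
* THE `r₂ = 3` CORNER (first example anywhere; REF1-AUDIT §11 had flagged `r ≥ 2` untested): 8961b1 (`N = 8961 ≡ 1 (8)`, `a₂ = 0`,
  `w = −1`, `r = 1`; `E^{(8)}`: `N = 573504`, `r_an = 3`, three independent points): `s = s′ = s″ = b = b′ = 0` to `2³³` (engine52,
  kit j342001) AND `λ♭ = 3`, `λ♯ = 4`, `μ = −1` stable over levels `4…9` (theta53, j342028) ⇒ by the zero budget `λ = ord₀ + ord₋₂ + 2k`:
  `ord₋₂ L♭ = 2 = |3 − 1|` and `ord₋₂ L♯ = 3` EXACTLY, no other zeros — `HasOrderAtNegTwo L♯ 3 ∧ HasOrderAtNegTwo L♭ 2` certified by two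
  engines; also the first odd-locus row whose blind VALUE `b` vanishes (44A±'s hypothesis `W₂.analyticRank = 1` is sharp).
* TWO-ENGINE EXCESS LAWS (§B, "+" branch, `a₂ = 0`, 1132 data): `v₂(leading ♭-datum) − μ♭ = r + Σ_(extra ι-pairs)` and the `♯` twin hold
  with **0 violations**: equality `e = r` on exactly the rows with `λ = r + exponent` (387 ♭ / 212 ♯), strict excess on the rows with
  extra zeros — the Mazur–Tate side and the OMS side agree bit-exactly in normalisation (no calibration constant).
* `a₂ = ±2` BLIND COMBINATION (§C): `L_bl := 5·L♭ + a₂·L♯` has `L_bl(ψ₂) = 0` on all 284 even-locus rows (tree theorem, re-measured) and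
  `L_bl′(ψ₂) = 5b′ + a₂s′ ≠ 0` on **284/284** of them (P-an-45T's simple zero); odd locus: `L_bl(ψ₂) ≠ 0` on 356/356.
* FE DERIVATIVE SHADOWS (§D, exact 2-adic pair fits, both branches): odd locus `b′/b = l/2 − 1/6` and `s″/s′ = l + 1/3`, even locus
  `s′/s = l/2 − 1/3` (`a₂ = 0`; `l = c` = Teichmüller exponent of `N`) on **1041 rows, single fit key each** — exactly
  `(c + b)/2`, `1 + (c + a)`, `(c + a)/2` with the tree's FE exponents `3a = −2`, `3b = −1` ⇒ engine `T` = tree `T`, engine `l(N)` = tree `c`,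
  and engine52's second-order channel is certified to full precision; `a₂ = ±2` (no scalar FE; MIXED shadows of the pair's
  matrix FE): `b′ = (c/2 + 1/10)·b − (a₂/5)·s′` and `s″ = (c − 1/5)·s′ + (2a₂/5)·b` on the odd locus, `s′ = (c/2 − 3/5)·s` on the even
  locus — ONE fit key in every (a₂, branch) cell (CensusAN48 §D; recorded, not typed).
* FREE INVARIANT: on the even locus the blind derivative `b′` (rank `0`: "♭-height of the Kato class"; rank `2`: a `2 × 2` ♭-regulator) is NOT a
  shadow: `b′/s` vs `l` takes 693 distinct fit keys on 410 rows (pre-registered H_free confirmed; H_rigid dead); its valuation obeys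
  only the excess law above; unit statistics `u(b′) mod 8` show no law against `Tam·Ш(E₈)`, `N mod 16` (§F) — consistent with a
  transcendental leading coefficient (Perrin-Riou/Rubin-type formula; card `Ideas/blind-rubin-formula-at-psi2.md` v8).

References: [Sprung2017] Thm. 1.12, Cor. 4.4, Cor. 4.14; [MazurTateTeitelbaum1986Invent] §I.13, §I.17, §II; [KuriharaOtsuki2006] Prop. 1.3;
[DionSprung2019] Thm. 4.1/5.1; Castella 2025 arXiv:2502.19618 (Perrin-Riou formula for SIGNED Selmer groups — `p` odd, `a_p = 0`, `T = 0`: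
the nearest printed leading-term statement; nothing at an order-2 character, nothing at `p = 2`); tree `F1Sign2.BlindOrderAtChi8`,
`F1Sign2.BlindOrderOddBranchAtTwo`, `F1Sign2.OddBranchFunctionalEquationAtTwo`, `Literature.Barriers…PAdicFunctionalEquationSharpFlatTwoProofs`,
`Supersingular.BlindPointFlatTwo`, `Supersingular.BlindPointDerivAt`; HOME MEMO-an.md v2.04 §45, CensusAN48.md, MEMO-an-data/g41/.
-/

set_option autoImplicit false

noncomputable section

open scoped Classical MatrixGroups ModularForm

open PowerSeries WeierstrassCurve CongruenceSubgroup Literature.NumberTheory.EllipticCurves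
  Literature.NumberTheory.EllipticCurves.ModularForms Literature.NumberTheory.EllipticCurves.Sprung2017
  Literature.NumberTheory.EllipticCurves.Rank1Residual
  Summit.BirchSwinnertonDyer.Rank1Residual.Supersingular
  Summit.BirchSwinnertonDyer.Rank1Residual.Supersingular.BlindLever
  Summit.BirchSwinnertonDyer.Rank1Residual.F1Sign2

namespace Summit.BirchSwinnertonDyer.Cruxes.RankOneAtTwoBigImageOddLocal.BlindGZAN59

/-- **P-an-45D `HasOrderAtNegTwoIffTaylor` (support; THEOREM EXPECTED — pure algebra in `Λ = ℤ₂⟦T⟧`).** The Taylor dictionary at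
the order-2 character: `(T+2)^n ∣ L ∧ (T+2)^{n+1} ∤ L` iff the first `n` derivatives of `L` vanish at `T = −2` and the `n`-th does not
(`BlindLever.evalAt (−2)` of the iterated `PowerSeries.derivative`). Proof sketch: the kernel of the continuous evaluation `T ↦ −2` is
`(T + 2)` (Weierstrass division by the distinguished polynomial `T + 2`, tree `prime_X_add_C_two`); if `L = (T+2)·M` then
`L^{(k)} = k·M^{(k−1)} + (T+2)·M^{(k)}`, so `L^{(k)}(−2) = k·M^{(k−1)}(−2)` and one inducts (`ℤ₂` is a domain of characteristic `0`, the
factorials are harmless). ROLE: turns AN-5 `BlindOrderAtChi8`, AN-6 `BlindOrderOddBranchAtTwo` and P-an-45T into statements decidable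
row by row from the engine's Taylor data `(s, s′, s″ | b, b′)` — CensusAN48 §A is stated through it (2417/2417 rows conform,
0 violations). WHY IT MIGHT FAIL: it cannot mathematically; only a typing slip (coercions `IwasawaAlgebra 2 = ℤ_[2]⟦X⟧`, the junk
case `n = 0` is fine: `(∀ k < 0, …)` is vacuous and `(T+2)^0 ∣ L`). WHY FILED: the gate wants the dictionary as a citable decl before a
prover closes any `HasOrderAtNegTwo` instance numerically-guided. Sources: [folklore] (Weierstrass preparation, e.g. Washington, Cyclotomic
Fields, §7.1); tree `F1Sign2.HasOrderAtNegTwo`, `BlindLever.derivAt`. -/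
@[conjecture] def HasOrderAtNegTwoIffTaylor : Prop :=
  ∀ (L : IwasawaAlgebra 2) (n : ℕ),
    HasOrderAtNegTwo L n ↔
      ((∀ k : ℕ, k < n → evalAt (-2 : ℤ_[2]) ((⇑(PowerSeries.derivative ℤ_[2]))^[k] L) = 0) ∧
        evalAt (-2 : ℤ_[2]) ((⇑(PowerSeries.derivative ℤ_[2]))^[n] L) ≠ 0)

/-- **P-an-45T `BlindOrderAtChi8TraceTwo` (conjecture; NEW — the `a₂ = ±2` order law at `χ₈`).** For `E` good supersingular at `2`
with `a₂ = ±2` (the only non-zero supersingular traces at `2`), `(L♯, L♭)` its Sprung pair (`IsSprungPair f 2 a₂`, exists and is unique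
at `a₂ = ±2`), `E₂` any model of `E ⊗ χ₈` and `r₂ = r_an(E₂)`:
`ord₋₂ L♯ = r₂`, `ord₋₂ L♭ = r₂ ∸ 1` (truncated subtraction) and `ord₋₂ (5·L♭ + a₂·L♯) = |r₂ − 1|` — the ♭-function is
"honest minus one" and the BLIND COMBINATION `L_bl = 5L♭ + a₂L♯` (whose VALUE at `ψ₂` vanishes on the even locus `w·χ₈(N) = +1` by the
tree theorem `BlindFlat.flatLaw_evalAt_neg_two_cases`) carries the sign-forced simple zero: exponents `(r₂, r₂∸1, |r₂−1|) =
(0,0,1), (1,0,0), (2,1,1), (3,2,2)` (`traceTwoExponent_values`). HEURISTIC: two-root `2`-adic BSD at the character `ψ₂`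
(`ord_{ψ₂} L_α = ord_{ψ₂} L_β = r₂`, MTT §II) transported through Sprung's factorisation `(L_α, L_β) = 2·(L♯, L♭)·Log(T)`, whose
`Log` matrix at `u := T + 2 = 0` is `Log(−2) = [[−α⁻³, −β⁻³], [0, 0]]` (engine52 closed form, checked three ways): the ♭-ROW VANISHES,
so `L♭(ψ₂)` is BLIND to both `L_α(ψ₂)`, `L_β(ψ₂)`, while the `u`-coefficient of the ♭-row, `(l₂₁, l₂₂)`, is independent of the ♯-row
(`D_l := α³l₂₁ − β³l₂₂ ≠ 0`, the engine divides by it). Solving `L_α ≡ L_β ≡ 0 (mod u^{r₂})` order by order: `u⁰` gives `s₀ = 0`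
(if `r₂ ≥ 1`); `u^k` gives the `2 × 2` system `−α⁻³s_k + l₂₁b_{k−1} = −β⁻³s_k + l₂₂b_{k−1} = 0` of determinant `∝ D_l`, hence
`s_k = b_{k−1} = 0` for `k < r₂`: `ord L♯ ≥ r₂`, `ord L♭ ≥ r₂ − 1`, generically sharp — for EVERY `a₂`. What distinguishes the traces
is only `r₂ = 0`: for `a₂ = 0` the scalar FE of `L♭` (sign `ε(c+b) = −ε(c+a)`) forces the blind value to vanish on the even locus
(`ord L♭` odd ⇒ `= 1 = |0 − 1|`, AN-5), whereas for `a₂ = ±2` the pair has only a MATRIX FE, whose fixed-point relation is the value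
law `5b₀ + a₂s₀ = 0` (tree theorem) — `L♭(ψ₂) = −a₂s₀/5 ≠ 0` and the sign-forced simple zero moves to `L_bl = 5L♭ + a₂L♯`; for
`r₂ ≥ 1` the third exponent `|r₂ − 1|` follows from the first two (`s_{r₂−1} = 0`). Exactness of the leading pair `(s_{r₂}, b_{r₂−1})`
is the non-degeneracy of a `ψ₂`-adic height pairing (no theory at `p = 2`). BC5 WITNESS (CensusAN48 §A/§C, kit j341999/j342000, engine52 on all
640 optimal `a₂ = ±2` classes with `N ≤ 3000`, both signs = 640 rows): zero pattern of `(s, s′, s″ | b, b′)` as predicted on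
**640/640 rows, 0 violations** (`r₂ = 0`: 227; `r₂ = 1`: 356; `r₂ = 2`: 57); `L_bl(ψ₂) = 0` and `L_bl′(ψ₂) = 5b′ + a₂s′ ≠ 0` on
**284/284** even-locus rows; `r₂ = 2`: `s = s′ = b = 0`, `s″ ≠ 0`, `b′ ≠ 0` on 57/57. CHEAPEST FALSIFIER (run, 0 hits): one
even-locus row with `5b′ + a₂s′ = 0`, or one `r₂ = 2` row with `b′ = 0` or `s″ = 0`, or one `r₂ = 1` row with `s′ = 0`. WHY IT MIGHT
FAIL: (i) `r₂ ≥ 2` exactness = non-degeneracy of a `2`-adic height pairing at `ψ₂` for the additive twist `E₂` — nothing known, and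
an accidental extra zero AT `ψ₂` (not merely near it) on some row would break "=" while keeping "≥"; (ii) at `a₂ = ±2` there is no
scalar functional equation for `L♯`, `L♭` separately, so an unforeseen second relation among `(s′, b′)` on the even locus would push
`ord L_bl` to `≥ 2` — the census says the pair `(s″, b′)` is free (284/284); (iii) no `r₂ ≥ 3` row with `a₂ = ±2` is known
(`N < 10⁴` scanned: none), so the corner `(3,2,2)` is untested here (its `a₂ = 0` twin holds on 8961b1). WHY NOVEL: the tree has the
`a₂ = ±2` λ-shadow (AN-5T) and the value law only; in print the order of `♯/♭` (or `±`) `p`-adic L-functions at a character of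
order two is treated nowhere (corpus fts+vec: nearest Castella 2025 arXiv:2502.19618 — signed leading terms at `T = 0`, `p` odd;
Kobayashi 2013, Kriz 2021: 0 hits for «order of vanishing»/«finite order character»; galaxy «exceptional zero|extra zero|trivial
zero», «sharp p-adic|flat p-adic|chromatic Selmer»: 0 relevant) — VARIANT-TRANSPLANT of `p`-adic BSD at `ψ₂` + Sprung's `Log` matrix,
new as a statement. Sources: [Sprung2017] Thm. 1.12, Cor. 4.4; [MazurTateTeitelbaum1986Invent] §II; tree
`BlindFlat.flatLaw_evalAt_neg_two_cases`, `F1Sign2.SignedLambdaBoundsAtChi8TraceTwo`; CensusAN48. -/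
@[conjecture] def BlindOrderAtChi8TraceTwo : Prop :=
  ∀ {N : ℕ} [NeZero N] (f : CuspForm (Gamma0 N) 2) (W : WeierstrassCurve ℚ) [W.IsElliptic] [W.IsGloballyMinimal]
    (W₂ : WeierstrassCurve ℚ) [W₂.IsElliptic] (Lsharp Lflat : IwasawaAlgebra 2),
    IsNewformOf W f → GoodSS W 2 → (W.frobeniusTrace 2 = 2 ∨ W.frobeniusTrace 2 = -2) →
    IsSprungPair f 2 (W.frobeniusTrace 2) Lsharp Lflat →
    (∃ C : WeierstrassCurve.VariableChange ℚ, C • W.quadraticTwist 2 = W₂) →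
    HasOrderAtNegTwo Lsharp W₂.analyticRank ∧
      HasOrderAtNegTwo Lflat (W₂.analyticRank - 1) ∧
      HasOrderAtNegTwo (5 * Lflat + PowerSeries.C (((W.frobeniusTrace 2 : ℤ)) : ℤ_[2]) * Lsharp)
        (((W₂.analyticRank : ℤ) - 1).natAbs)

/-- **P-an-45T⁻ `OddBlindOrderAtChiMinus8TraceTwo` (conjecture; the odd-branch twin of P-an-45T).** On Sprung's odd branch
(`IsSprungPairOdd f 2 a₂`, characters `χ₋₄` at `T = 0` and `χ₋₈` at `T = −2`; `p = 2` is the only prime where this branch is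
self-dual) with `a₂ = ±2`, `E₋₂` any model of `E ⊗ χ₋₈` and `r₋₂ = r_an(E₋₂)`: `ord₋₂ L♯₋ = r₋₂`, `ord₋₂ L♭₋ = r₋₂ ∸ 1`,
`ord₋₂ (5·L♭₋ + a₂·L♯₋) = |r₋₂ − 1|`. Its VALUE part — `5·L♭₋(−2) + a₂·L♯₋(−2) = 0` on the even locus `w·χ₋₈(N) = −1` — is the
odd-branch analogue of `BlindFlat.flatLaw_evalAt_neg_two_cases` and is NOT yet a tree theorem (the odd-branch files
`F1Sign2.OddBranch*AtTwo` are `a₂ = 0`); it is expected to follow from the finite-level FE of `θ⁻_n` exactly as on the even branch.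
BC5 WITNESS (CensusAN48 §A/§C, "−" rows of the 640 `a₂ = ±2` classes): zero pattern as predicted on **640/640 rows,
0 violations** (`r₋₂ = 0`: 244; `1`: 342; `2`: 54); `L_bl(χ₋₈) = 0 ∧ L_bl′(χ₋₈) ≠ 0` on **298/298** even-locus
rows; odd locus `L_bl(χ₋₈) ≠ 0` on 342/342. CHEAPEST FALSIFIER / WHY IT MIGHT FAIL: as P-an-45T, plus (iv) the value law itself is
only measured here (engine), not proved on this branch. WHY NOVEL: as P-an-45T; the odd branch at `p = 2` has no statement of any
kind in print. Sources: as P-an-45T; tree `Literature…MazurTateElementOdd` (`IsSprungPairOdd`, `mazurTateElementOdd`),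
`F1Sign2.BlindOrderOddBranchAtTwo`. -/
@[conjecture] def OddBlindOrderAtChiMinus8TraceTwo : Prop :=
  ∀ {N : ℕ} [NeZero N] (f : CuspForm (Gamma0 N) 2) (W : WeierstrassCurve ℚ) [W.IsElliptic] [W.IsGloballyMinimal]
    (Wm2 : WeierstrassCurve ℚ) [Wm2.IsElliptic] (Lsharp Lflat : IwasawaAlgebra 2),
    IsNewformOf W f → GoodSS W 2 → (W.frobeniusTrace 2 = 2 ∨ W.frobeniusTrace 2 = -2) →
    IsSprungPairOdd f 2 (W.frobeniusTrace 2) Lsharp Lflat →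
    (∃ C : WeierstrassCurve.VariableChange ℚ, C • W.quadraticTwist (-2) = Wm2) →
    HasOrderAtNegTwo Lsharp Wm2.analyticRank ∧
      HasOrderAtNegTwo Lflat (Wm2.analyticRank - 1) ∧
      HasOrderAtNegTwo (5 * Lflat + PowerSeries.C (((W.frobeniusTrace 2 : ℤ)) : ℤ_[2]) * Lsharp)
        (((Wm2.analyticRank : ℤ) - 1).natAbs)

/-- **P-an-45S⁺ `SharpFlatDerivativeShadowsAtTwo` (support; THEOREM EXPECTED — corollary of the in-tree even-branch functional
equations `subst_invOnePlusSubOne_eq_of_isSprungPair_two`: `L♯(T^ι) = σ(1+T)^{c+a}L♯(T)`, `L♭(T^ι) = σ(1+T)^{c+b}L♭(T)`, `3a = −2`,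
`3b = −1`, `N = η_N·5^c`).** Differentiating at the fixed point `T = −2` (`ι(−2) = −2`, `ι′(−2) = −1`, `(1+T)^{x−1}|_{−2} = −(1+T)^x|_{−2}`)
gives `L′(1 + σε) = σε·x·L` with `ε = (1+T)^x|_{T=−2}`; on the locus where `σε(c+a) = +1` — the even locus `w·χ₈(N) = +1`, by the same
sign bookkeeping that proves the flat law (`ε(c+b) = −ε(c+a)` since the cube root of `−1` in `ℚ₂` is `−1`) — this reads
`6·L♯′(−2) = (3c − 2)·L♯(−2)`, and on the odd locus `w·χ₈(N) = −1`: `6·L♭′(−2) = (3c − 1)·L♭(−2)` and (second order at the forced zero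
of `L♯`) `3·L♯″(−2) = (3c + 1)·L♯′(−2)`. BC5 WITNESS (CensusAN48 §D, engine52, `a₂ = 0`, "+" branch, `N ≤ 3000`): exact 2-adic pair fits
`s′/s = −1/3 + l/2` (213 even-locus rows), `b′/b = −1/6 + l/2` and `s″/s′ = 1/3 + l` (304 odd-locus rows), ONE fit key each, agreement
to the full engine precision (≥ 30 bits) — which is also the certificate that engine52's `T`, `l(N)` and derivative sign are the
tree's `T`, `c`. WHY IT MIGHT FAIL: only by a convention slip in the typing (orientation of `γ ↦ 1+T`, the locus ↔ `σε` dictionary);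
the identities themselves are forced by the FE. WHY FILED: they are the order-1/order-2 analogues of the value-level "IN-PRINT-ASSEMBLY"
readings (Dion–Sprung 2019 Thm. 4.1/5.1) the refuters asked to see as decls, and the calibration backbone of CensusAN48. Sources:
[Sprung2017] Cor. 4.14; [MazurTateTeitelbaum1986Invent] §I.17; [DionSprung2019] Thm. 4.1, 5.1; tree
`Literature.Barriers.BirchSwinnertonDyer.PAdicFunctionalEquationSharpFlatTwoProofs` (`subst_invOnePlusSubOne_eq_of_isSprungPair_two`),
`exists_teichmuller_exponent_natCast`, `BlindLever.derivAt`. -/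
@[conjecture] def SharpFlatDerivativeShadowsAtTwo : Prop :=
  ∀ {N : ℕ} [NeZero N] (f : CuspForm (Gamma0 N) 2) (W : WeierstrassCurve ℚ) [W.IsElliptic] [W.IsGloballyMinimal]
    (Lsharp Lflat : IwasawaAlgebra 2),
    IsNewformOf W f → GoodSS W 2 → W.frobeniusTrace 2 = 0 →
    IsSprungPair f 2 (W.frobeniusTrace 2) Lsharp Lflat →
    ∀ {ηN : rootsOfUnity (torsionOrder 2) ℤ_[2]} {c : ℤ_[2]},
    (∀ n : ℕ, PadicInt.toZModPow (n + cyclotomicExponent 2) ((ηN : ℤ_[2]ˣ) : ℤ_[2]) *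
      (cyclotomicGenerator 2 : ZMod (2 ^ (n + cyclotomicExponent 2))) ^
        (PadicInt.toZModPow n c).val = (N : ZMod (2 ^ (n + cyclotomicExponent 2)))) →
    (W.rootNumber * ZMod.χ₈ (N : ZMod 8) = 1 →
        6 * derivAt (-2 : ℤ_[2]) Lsharp = (3 * c - 2) * evalAt (-2 : ℤ_[2]) Lsharp) ∧
    (W.rootNumber * ZMod.χ₈ (N : ZMod 8) = -1 →
        6 * derivAt (-2 : ℤ_[2]) Lflat = (3 * c - 1) * evalAt (-2 : ℤ_[2]) Lflat ∧
        3 * evalAt (-2 : ℤ_[2]) (PowerSeries.derivative ℤ_[2] (PowerSeries.derivative ℤ_[2] Lsharp)) =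
          (3 * c + 1) * derivAt (-2 : ℤ_[2]) Lsharp)

/-- **P-an-45S⁻ `OddSharpFlatDerivativeShadowsAtTwo` (support; THEOREM EXPECTED — the same corollary on Sprung's odd branch, from
`F1Sign2.subst_invOnePlusSubOne_eq_of_isSprungPairOdd_two`: `L♯₋(T^ι) = −σe(1+T)^{c+a}L♯₋`, `L♭₋(T^ι) = −σe(1+T)^{c+b}L♭₋`,
`e = η_N = χ₋₄(N)`).** With the odd-branch loci read through `χ₋₈ = ZMod.χ₈'` (rank-one/odd locus of `E^{(−2)}`: `w·χ₋₈(N) = +1`; even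
locus: `−1`): even locus `6·L♯₋′(−2) = (3c − 2)·L♯₋(−2)`; odd locus `6·L♭₋′(−2) = (3c − 1)·L♭₋(−2)` and `3·L♯₋″(−2) = (3c + 1)·L♯₋′(−2)`
— the SAME constants as on the even branch (the extra sign `−e` moves the loci, not the exponents). BC5 WITNESS (CensusAN48 §D, "−"
rows, `a₂ = 0`, `N ≤ 3000`): `s′/s = −1/3 + l/2` (197 rows), `b′/b = −1/6 + l/2`, `s″/s′ = 1/3 + l` (327 rows), one fit key
each, full precision. WHY IT MIGHT FAIL / WHY FILED / Sources: as P-an-45S⁺; tree `F1Sign2.OddBranchFunctionalEquationAtTwo`,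
`Literature…MazurTateElementOdd` (`IsSprungPairOdd`). -/
@[conjecture] def OddSharpFlatDerivativeShadowsAtTwo : Prop :=
  ∀ {N : ℕ} [NeZero N] (f : CuspForm (Gamma0 N) 2) (W : WeierstrassCurve ℚ) [W.IsElliptic] [W.IsGloballyMinimal]
    (Lsharp Lflat : IwasawaAlgebra 2),
    IsNewformOf W f → GoodSS W 2 → W.frobeniusTrace 2 = 0 →
    IsSprungPairOdd f 2 (W.frobeniusTrace 2) Lsharp Lflat →
    ∀ {ηN : rootsOfUnity (torsionOrder 2) ℤ_[2]} {c : ℤ_[2]},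
    (∀ n : ℕ, PadicInt.toZModPow (n + cyclotomicExponent 2) ((ηN : ℤ_[2]ˣ) : ℤ_[2]) *
      (cyclotomicGenerator 2 : ZMod (2 ^ (n + cyclotomicExponent 2))) ^
        (PadicInt.toZModPow n c).val = (N : ZMod (2 ^ (n + cyclotomicExponent 2)))) →
    (W.rootNumber * ZMod.χ₈' (N : ZMod 8) = -1 →
        6 * derivAt (-2 : ℤ_[2]) Lsharp = (3 * c - 2) * evalAt (-2 : ℤ_[2]) Lsharp) ∧
    (W.rootNumber * ZMod.χ₈' (N : ZMod 8) = 1 →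
        6 * derivAt (-2 : ℤ_[2]) Lflat = (3 * c - 1) * evalAt (-2 : ℤ_[2]) Lflat ∧
        3 * evalAt (-2 : ℤ_[2]) (PowerSeries.derivative ℤ_[2] (PowerSeries.derivative ℤ_[2] Lsharp)) =
          (3 * c + 1) * derivAt (-2 : ℤ_[2]) Lsharp)

/-- Bookkeeping (proved): the three exponents of P-an-45T at `r₂ = 0, 1, 2, 3`:
`(r₂, r₂ ∸ 1, |r₂ − 1|) = (0,0,1), (1,0,0), (2,1,1), (3,2,2)` — the flat function is honest-minus-one and only the
blind combination carries the forced zero at `r₂ = 0`. [folklore] -/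
theorem traceTwoExponent_values :
    ((0 : ℕ) - 1 = 0 ∧ (((0 : ℕ) : ℤ) - 1).natAbs = 1) ∧ ((1 : ℕ) - 1 = 0 ∧ (((1 : ℕ) : ℤ) - 1).natAbs = 0) ∧
      ((2 : ℕ) - 1 = 1 ∧ (((2 : ℕ) : ℤ) - 1).natAbs = 1) ∧ ((3 : ℕ) - 1 = 2 ∧ (((3 : ℕ) : ℤ) - 1).natAbs = 2) := by
  decide

/-- Bookkeeping (proved): for `1 ≤ r`, `r ∸ 1 = |r − 1|` — the two ♭-type exponents of P-an-45T agree off `r₂ = 0`.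
[folklore] -/
theorem sub_one_eq_natAbs_of_one_le {r : ℕ} (hr : 1 ≤ r) : r - 1 = (((r : ℤ) - 1).natAbs) := by
  omega

end Summit.BirchSwinnertonDyer.Cruxes.RankOneAtTwoBigImageOddLocal.BlindGZAN59

end
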